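import Summits.Ventures.HodgeRepro.Tier4.LitMuInvariant

/-!
# LitMuInvariantApi — API of the μ-invariant `muInv` (Tier4/LitMuInvariant): scalars, the `ϖ^μ`-extraction, and
invariance under endomorphisms that are the identity mod `ϖ`

Blind re-derivation cell `pub-hodge-repro`, Tier-4 literature seat `t4-lit-4` (gen 0).  Target tree path
`lean/Summits/Ventures/HodgeRepro/Tier4/LitMuInvariantApi.lean`; imports `Tier4/LitMuInvariant` (Mathlib only below it).

Mathlib-level lemmas about the definition `muInv (G : MvPowerSeries σ A) = ⨅ m, addVal A (coeff m G)` over a DVR `A`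
(the Iwasawa μ-invariant of an element of `A⟦Γ⟧ ≅ A⟦T_i⟧`), offered to LINE L2 (t4-plan-2, Skeleton v0.5) whose lemma
`muInv_map_eq_of_residue_comm` (t4-L2-p3) is the instance `σ = Fin d`, `A = O.A` of `muInv_map_eq_of_map_residue_eq`
below:

* `muInv_smul_pow` — `μ(ϖ^m • G) = m + μ(G)` for a uniformiser `ϖ`;
* `exists_smul_eq_of_muInv_eq_natCast` — `μ(G) = m < ∞` ⇒ `G = ϖ^m • G′` with `μ(G′) = 0`;
* `muInv_map_eq_of_map_residue_eq` — for an `A`-algebra endomorphism `Φ` of `A⟦T_i⟧` with `Φ(F) ≡ F (mod ϖ)` for every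
  `F` (as maps to the residue field), `μ(Φ F) = μ(F)`: write `F = ϖ^μ F′`, `F′ ≢ 0`; `Φ F = ϖ^μ Φ(F′)` and `Φ(F′) ≡ F′ ≢ 0`.

Nothing about Hecke characters, measures or L-values is involved.  Nothing here says anything about the status of the
Hodge conjecture for CM abelian varieties, which is NOT proved.
-/

set_option autoImplicit false

namespace Summit.Ventures.HodgeRepro.Tier4.Lit.MuInvariant

open IsDiscreteValuationRing

variable {A : Type*} [CommRing A] [IsDomain A] [IsDiscreteValuationRing A] {σ : Type*}

/-- `μ(ϖ^m • G) = m + μ(G)` for a uniformiser `ϖ`. -/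
theorem muInv_smul_pow {ϖ : A} (hϖ : Irreducible ϖ) (m : ℕ) (G : MvPowerSeries σ A) :
    muInv (ϖ ^ m • G) = (m : ℕ∞) + muInv G := by
  unfold muInv
  rw [ENat.add_iInf]
  refine iInf_congr fun n => ?_
  rw [MvPowerSeries.coeff_smul, addVal_mul, addVal_pow, addVal_uniformizer hϖ, nsmul_eq_mul, mul_one]

/-- the `ϖ^m`-extraction: `μ(G) = m` (a natural number) gives `G = ϖ^m • G′` with `μ(G′) = 0`. -/
theorem exists_smul_eq_of_muInv_eq_natCast {ϖ : A} (hϖ : Irreducible ϖ) {G : MvPowerSeries σ A} {m : ℕ}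
    (h : muInv G = m) : ∃ G' : MvPowerSeries σ A, G = ϖ ^ m • G' ∧ muInv G' = 0 := by
  have hdvd : ∀ n : σ →₀ ℕ, ϖ ^ m ∣ MvPowerSeries.coeff n G := by
    intro n
    rw [← addVal_le_iff_dvd, addVal_pow, addVal_uniformizer hϖ, nsmul_eq_mul, mul_one, ← h]
    exact iInf_le _ n
  choose q hq using hdvd
  let G' : MvPowerSeries σ A := q
  have hq' : ∀ n : σ →₀ ℕ, MvPowerSeries.coeff n G' = q n := fun _ => rfl
  have hG : G = ϖ ^ m • G' := by
    apply MvPowerSeries.ext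
    intro n
    rw [MvPowerSeries.coeff_smul, hq']
    exact hq n
  refine ⟨G', hG, ?_⟩
  have hμ : muInv (ϖ ^ m • G') = (m : ℕ∞) + muInv G' := muInv_smul_pow hϖ m G'
  rw [← hG, h] at hμ
  have hm : (m : ℕ∞) ≠ ⊤ := ENat.coe_ne_top m
  have h0 : (m : ℕ∞) + 0 = (m : ℕ∞) + muInv G' := by rw [add_zero]; exact hμ
  exact (ENat.add_right_injective_of_ne_top hm h0).symm

/-- **μ is invariant under an `A`-algebra endomorphism which is the identity mod `ϖ`**: if
`Φ : A⟦T_i⟧ →ₐ[A] A⟦T_i⟧` satisfies `map (residue A) (Φ F) = map (residue A) F` for every `F`, then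
`μ(Φ F) = μ(F)`.  (LINE L2's `muInv_map_eq_of_residue_comm`, t4-L2-p3, is the case `σ = Fin d`, `A = O.A`.) -/
theorem muInv_map_eq_of_map_residue_eq (Φ : MvPowerSeries σ A →ₐ[A] MvPowerSeries σ A)
    (hΦ : ∀ F, MvPowerSeries.map (IsLocalRing.residue A) (Φ F) = MvPowerSeries.map (IsLocalRing.residue A) F)
    (F : MvPowerSeries σ A) : muInv (Φ F) = muInv F := by
  obtain ⟨ϖ, hϖ⟩ := exists_irreducible A
  rcases eq_or_ne F 0 with rfl | hF
  · rw [map_zero]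
  -- `μ(F) = m < ∞`
  have hne : muInv F ≠ ⊤ := (muInv_ne_top_iff F).mpr hF
  obtain ⟨m, hm⟩ := ENat.ne_top_iff_exists.mp hne
  obtain ⟨G, rfl, hG⟩ := exists_smul_eq_of_muInv_eq_natCast hϖ hm.symm
  -- `Φ(ϖ^m • G) = ϖ^m • Φ G`
  have hΦG : Φ (ϖ ^ m • G) = ϖ ^ m • Φ G := by
    rw [MvPowerSeries.smul_eq_C_mul, MvPowerSeries.smul_eq_C_mul, map_mul]
    congr 1
    exact Φ.commutes (ϖ ^ m)
  rw [hΦG, muInv_smul_pow hϖ, muInv_smul_pow hϖ, hG]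
  congr 1
  -- `μ(Φ G) = 0` since `Φ G ≡ G ≢ 0 (mod ϖ)`
  rw [muInv_eq_zero_iff_map_residue_ne_zero, hΦ G, ← muInv_eq_zero_iff_map_residue_ne_zero]
  exact hG

end Summit.Ventures.HodgeRepro.Tier4.Lit.MuInvariant
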